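import Summits.SmoothPoincare4.SmoothPoincare4.Theorems.CylinderEntropyCylinderRungTwoMinimalIsSlice
import Summits.SmoothPoincare4.SmoothPoincare4.Theorems.CylinderEntropyCylinderRungTwoTranslatorIsMinimal
import HarnessLib

/-!
# Route `CylinderEntropy`, crux `CylinderRungTwo` (stmt-SmoothPoincare4-7631), line `killing-flux`:
# COMPACT TRANSLATING SOLITONS OF `N = S⁴ × ℝ` ARE SLICES

Registered helper `helper_translatorIsSlice` (lead c6), the last piece of the c6 RIGIDITY LAYER: a compact connected smoothly
embedded cross-section `ι : M → N` with smooth unit normal `ν` tangent to `N` that moves by TRANSLATION along the vertical Killing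
field `e₅` — i.e. satisfies the soliton equation `H = a ν₅` for some speed `a ∈ ℝ` (the static case `a = 0` included) — is a
slice `S⁴ × {c}`, and `M ≅ S⁴`.  Composition of the two landed rigidity theorems `helper_translatorIsMinimal` (the Killing identity
`∫ H ν₅ dμ_g = 0` forces `H ≡ 0`) and `range_eq_sliceMap_and_diffeo_of_meanCurvature_eq_zero` (ONLY SLICES ARE MINIMAL).  So the
only compact self-similar solutions of the cross-section flow driven by the translations of `N` are its fixed points, the slices.
Everything is PROVED (no `sorry`, no definition, no named fact).

Reference: R. S. Hamilton, *Monotonicity formulas for parabolic flows on manifolds*, Comm. Anal. Geom. 1 (1993) 127–137, §4 (first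
variation along a Killing field).
-/

noncomputable section

-- the prescribed namespace `Summit.SmoothPoincare4.SmoothPoincare4.…` repeats `SmoothPoincare4`
set_option linter.dupNamespace false

open scoped Manifold ContDiff BigOperators

namespace Summit.SmoothPoincare4.SmoothPoincare4.Cruxes.CylinderRungTwo.KillingFlux

open Literature.Geometry.Riemannian
open Literature.Geometry.Lorentzian Literature.Geometry.Lorentzian.PseudoRiemannianMetric
open Literature.Geometry.Manifold.CylinderSlice

/-- **Registered helper `helper_translatorIsSlice` — compact translating solitons of `N` are slices.**  A compact connected smoothly
embedded cross-section of `N` with a smooth unit normal field tangent to `N` and `H = a ν₅` (translation along `e₅` with speed `a`)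
is a slice `S⁴ × {c}` and `≅ S⁴`: `helper_translatorIsMinimal` gives `H ≡ 0`, then only slices are minimal
(`range_eq_sliceMap_and_diffeo_of_meanCurvature_eq_zero`). [cite: Hamilton1993, §4] -/
theorem helper_translatorIsSlice :
    ∀ (M : Type) [TopologicalSpace M] [T2Space M] [SecondCountableTopology M]
      [ChartedSpace (EuclideanSpace ℝ (Fin 4)) M] [IsManifold (𝓡 4) ∞ M] [CompactSpace M] [ConnectedSpace M]
      [MeasurableSpace M] [BorelSpace M]
      (ι ν : M → EuclideanSpace ℝ (Fin 6)) (hι : Manifold.IsSmoothEmbedding (𝓡 4) (𝓡 6) ∞ ι)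
      (himm : (Literature.Geometry.Riemannian.euclideanMetric (EuclideanSpace ℝ (Fin 6))).IsSpacelikeImmersion (𝓡 4) ι),
      (∀ x, ∑ i : Fin 5, ι x (Fin.castSucc i) ^ 2 = 1) →
      ContMDiff (𝓡 4) (𝓡 6) ∞ ν →
      (Literature.Geometry.Riemannian.euclideanMetric (EuclideanSpace ℝ (Fin 6))).IsUnitNormal (𝓡 4) ι ν 1 →
      (∀ x, ∑ i : Fin 5, ν x (Fin.castSucc i) * ι x (Fin.castSucc i) = 0) →
      ∀ a : ℝ, (∀ x, (Literature.Geometry.Riemannian.euclideanMetric (EuclideanSpace ℝ (Fin 6))).meanCurvature ι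
          Literature.Geometry.Lorentzian.PseudoRiemannianMetric.contMDiff_pullbackBilin_holds himm ν x = a * ν x 5) →
      ∃ c : ℝ, Set.range ι = Set.range (Literature.Geometry.Manifold.CylinderSlice.sliceMap c) ∧
        Nonempty (M ≃ₘ⟮𝓡 4, 𝓡 4⟯ Metric.sphere (0 : EuclideanSpace ℝ (Fin 5)) 1) := by
  intro M _ _ _ _ _ _ _ _ _ ι ν hι himm hN hν hun hνN a hsol
  have hH := helper_translatorIsMinimal M ι ν himm hν hun hN hνN a hsol
  obtain ⟨c, -, hrange, hdiff⟩ :=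
    range_eq_sliceMap_and_diffeo_of_meanCurvature_eq_zero hι himm hN hν hun hνN hH
  exact ⟨c, hrange, hdiff⟩

end Summit.SmoothPoincare4.SmoothPoincare4.Cruxes.CylinderRungTwo.KillingFlux

end
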